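import Literature.NumberTheory.EllipticCurves.BhargavaShankarCongruenceCountFnProofs
import Literature.NumberTheory.EllipticCurves.BhargavaShankarBigStabilizers
import Literature.NumberTheory.EllipticCurves.BinaryQuarticIrreducibleDiscProofs
import Literature.MeasureTheory.Group.SL2CoordSetIntegral
import HarnessLib

/-!
# The upper bound of the averaging method with congruence conditions: integration over Gauss's
# fundamental domain and the orbit count (Bhargava–Shankar §2.3, §2.5)

`Proofs` file (theorems only: no definitions, no named facts). Topic
`Literature/NumberTheory/EllipticCurves`; continues `BhargavaShankarCongruenceCountFnProofs.lean`
(the pointwise majorant `N(g) ≤ A + B y(g)² 1_{y(g) ≤ √Λ}` of the counting function of a set of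
irreducible forms with prescribed reductions) using the unfolding identity
`∫_𝓕 N dμ = Σ_O w(O)` of `BhargavaShankarUnfolding.lean`, the coordinates and integrals of
`Literature/MeasureTheory/Group/SL2CoordSetIntegral.lean` (`∫ y²·y⁻² dx dy`), `μ(𝓕) = π²/3`
(`GL2ZFundamentalDomain`), the big-stabiliser bound of `BhargavaShankarBigStabilizers.lean` and
the finiteness of the orbit sets (`BinaryQuarticIrreducibleDiscProofs`).

Following Bhargava–Shankar (`arXiv:1006.1002v2`, §2.3: eqs. (5)–(7), Lemma 2.4, "cutting off the
cusp" (14)–(15), and §2.5 Thm 2.11), for the UPPER bound: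

* `lintegral_countFn_le` — integrating the majorant:
  `∫_𝓕 N dμ ≤ A · π²/3 + B · √Λ · π` with `A = #S X^{5/6} vol(B₁)/q⁵`, `B = #S · 576000 K Λ⁴`
  (`Λ ≍ X^{1/6}`, so the second term is `O(X^{3/4})`);
* `encard_stabilizer_le_two` — an integral form with `Δ ≠ 0` and no stabilising `γ ≠ ±1` has
  `|Stab_Γ| ≤ 2`; `finite_bigStab_orbits` — the orbits with a big stabiliser form a finite set
  (of size `≤ 32500 X^{2/3}`, `ncard_bigStab_orbits_le`);
* `encard_orbits_mul_le_lintegral` — **`#{generic orbits of 𝒮} · nᵣ μ(G₀)/2 ≤ ∫_𝓕 N dμ`**, for a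
  `Γ`-invariant set `𝒮` of forms of height `< X` all `SL₂^±(ℝ)`-equivalent to sections of `𝓛_X`
  whose real stabilisers have `≥ nᵣ` elements (eq. (7): each generic orbit has weight
  `w(O) = |Stab_ℝ| μ(G₀)/|Stab_Γ| ≥ nᵣ μ(G₀)/2`);
* `ncard_orbits_le` — **the count**:
  `#(Γ\𝒮) ≤ 32500 X^{2/3} + (2/(nᵣ μ(G₀))) · (A π²/3 + B √Λ π)`.

The type-by-type instantiation (sections, coverage, `nᵣ = 8, 8, 4`, `vol(B₁)`) giving the upper
half of Thm 2.12 with the constants of Thm 2.1 is the companion file.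

## References

* M. Bhargava, A. Shankar, Ann. of Math. (2) 181 (2015) 191–242, §2.3 (eqs. (5)–(7), (14)–(15),
  Lemma 2.4) and §2.5 Thm 2.11 (arXiv:1006.1002v2 numbering; Thm 2.12 published). [cite: BhargavaShankarAnnals2015, §2.3 and §2.5 Thm 2.11 (arXiv:1006.1002v2 numbering)]
-/

noncomputable section

open Real MeasureTheory Matrix Set Filter Topology
open scoped MatrixGroups ENNReal

namespace Literature.NumberTheory.EllipticCurves

namespace BinaryQuartic

open Literature.MeasureTheory.Group Literature.Algebra.EuclideanLattices

variable {K : ℕ} (D : Fin K → Piece)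

section Measure

variable [MeasurableSpace (Matrix (Fin 2) (Fin 2) ℝ)] [BorelSpace (Matrix (Fin 2) (Fin 2) ℝ)]

/-! ## Integration of the majorant over Gauss's fundamental domain -/

/-- `y(g)` is measurable. [folklore] -/
theorem measurable_yOf' : Measurable (yOf : Matrix (Fin 2) (Fin 2) ℝ → ℝ) :=
  Complex.measurable_im.comp measurable_coordC

omit [MeasurableSpace (Matrix (Fin 2) (Fin 2) ℝ)] [BorelSpace (Matrix (Fin 2) (Fin 2) ℝ)] in
/-- The part of Gauss's fundamental domain below height `Y` lies in the coordinate set of the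
rectangle `{|x| ≤ ½, √3/2 ≤ y ≤ Y}`. [folklore] -/
theorem gaussFD_inter_subset_coordSet (Y : ℝ) :
    gaussFD ∩ {g : Matrix (Fin 2) (Fin 2) ℝ | yOf g ≤ Y} ⊆ coordSet (rectBetween (Real.sqrt 3 / 2) Y) (arc 0 π) := by
  rintro g ⟨hg, hgY⟩
  obtain ⟨x, y, θ, hx, hy, -, hxg, hyg, -⟩ := exists_eq_iwasawaGinv_of_mem_gaussFD hg
  obtain ⟨hdet, -, hθ⟩ := hg
  refine ⟨hdet, ⟨?_, ?_, hgY⟩, hθ⟩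
  · show |xOf g| ≤ 1 / 2
    rw [hxg]; exact hx
  · show Real.sqrt 3 / 2 ≤ yOf g
    rw [hyg]; exact hy

/-- **`∫_{𝓕 ∩ {y ≤ Y}} y(g)² dμ(g) ≤ Y · π`** (`dμ = dx dy dθ / y²`, `θ ∈ [0, π)`, `|x| ≤ ½`).
[cite: BhargavaShankarAnnals2015, §2.3 (the integral of the error term over the main body, (14)–(15); arXiv:1006.1002v2 numbering)] -/
theorem lintegral_gaussFD_sq_le (Y : ℝ) :
    ∫⁻ g in gaussFD ∩ {g : Matrix (Fin 2) (Fin 2) ℝ | yOf g ≤ Y}, ENNReal.ofReal (yOf g ^ 2) ∂haarSL2pm ≤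
      ENNReal.ofReal Y * ENNReal.ofReal π := by
  have hinst : Fact (0 < 2 * π) := fact_two_pi_pos
  have ha : 0 < Real.sqrt 3 / 2 := by positivity
  have hπ : π < 0 + 2 * π := by linarith [Real.pi_pos]
  calc ∫⁻ g in gaussFD ∩ {g : Matrix (Fin 2) (Fin 2) ℝ | yOf g ≤ Y}, ENNReal.ofReal (yOf g ^ 2) ∂haarSL2pm
      ≤ ∫⁻ g in coordSet (rectBetween (Real.sqrt 3 / 2) Y) (arc 0 π), ENNReal.ofReal (yOf g ^ 2) ∂haarSL2pm :=
        lintegral_mono_set (gaussFD_inter_subset_coordSet Y)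
    _ = ∫⁻ g in coordSet (rectBetween (Real.sqrt 3 / 2) Y) (arc 0 π),
          (fun w : ℂ => ENNReal.ofReal (w.im ^ 2)) ⟨xOf g, yOf g⟩ ∂haarSL2pm := rfl
    _ = (∫⁻ w in rectBetween (Real.sqrt 3 / 2) Y, ENNReal.ofReal (w.im ^ 2) * ENNReal.ofReal (1 / w.im ^ 2) ∂volume) *
          volume (arc 0 π) :=
        setLIntegral_haarSL2pm_coordSet (measurableSet_rectBetween _ _) (rectBetween_subset ha)
          (measurableSet_arc hπ.le) (fun w : ℂ => ENNReal.ofReal (w.im ^ 2))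
          ((Complex.measurable_im.pow_const 2).ennreal_ofReal)
    _ = ENNReal.ofReal (Y - Real.sqrt 3 / 2) * ENNReal.ofReal (π - 0) := by
        rw [lintegral_rectBetween ha, volume_arc hπ]
    _ ≤ ENNReal.ofReal Y * ENNReal.ofReal π := by
        rw [sub_zero]
        gcongr
        linarith

/-- **Integration of the majorant** (Bhargava–Shankar's estimate of `(1/M) ∫ #{…} dg`, upper
half, with congruence conditions): for `X ≥ 1`, a set `𝒮` of irreducible integral forms with
reductions modulo `q` in `S`,
`∫_𝓕 N dμ ≤ #S X^{5/6} vol(B₁)/q⁵ · π²/3 + #S · 576000 K Λ⁴ · √Λ · π`.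
[cite: BhargavaShankarAnnals2015, §2.3 (12)–(15) and §2.5 Thm 2.11 (arXiv:1006.1002v2 numbering)] -/
theorem lintegral_countFn_le {X : ℝ} (hX : 1 ≤ X) {q : ℕ} [NeZero q] (S : Finset (Fin 5 → ZMod q))
    {𝒮 : Set (BinaryQuartic ℤ)} (hirr : ∀ f ∈ 𝒮, f.IsIrreducible)
    (hred : ∀ f ∈ 𝒮, (fun i => ((f.coeffs i : ℤ) : ZMod q)) ∈ S) :
    ∫⁻ g in gaussFD, countFn (sections D X) 𝒮 g ∂haarSL2pm ≤
      ENNReal.ofReal (S.card * (X ^ (5 / 6 : ℝ) * volume.real (B1set D) / (q : ℝ) ^ 5) * (π ^ 2 / 3) +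
        S.card * (576000 * K * Lam D X ^ 4) * (Real.sqrt (Lam D X) * π)) := by
  have hX0 : 0 < X := by linarith
  set A : ℝ := S.card * (X ^ (5 / 6 : ℝ) * volume.real (B1set D) / (q : ℝ) ^ 5) with hA
  set B : ℝ := S.card * (576000 * K * Lam D X ^ 4) with hB
  have hA0 : 0 ≤ A := by positivity
  have hB0 : 0 ≤ B := by have := Lam_pos D hX0; positivity
  set T : Set (Matrix (Fin 2) (Fin 2) ℝ) := {g | yOf g ≤ Real.sqrt (Lam D X)} with hT
  have hTm : MeasurableSet T := measurableSet_le measurable_yOf' measurable_const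
  have hind : Measurable fun g : Matrix (Fin 2) (Fin 2) ℝ => T.indicator (fun g => ENNReal.ofReal (yOf g ^ 2)) g :=
    (Measurable.ennreal_ofReal (measurable_yOf'.pow_const 2)).indicator hTm
  have hpt : ∀ g ∈ gaussFD, countFn (sections D X) 𝒮 g ≤
      ENNReal.ofReal A + ENNReal.ofReal B * T.indicator (fun g => ENNReal.ofReal (yOf g ^ 2)) g :=
    fun g hg => countFn_le_majorant D hX S hirr hred hg
  calc ∫⁻ g in gaussFD, countFn (sections D X) 𝒮 g ∂haarSL2pm
      ≤ ∫⁻ g in gaussFD, (ENNReal.ofReal A + ENNReal.ofReal B * T.indicator (fun g => ENNReal.ofReal (yOf g ^ 2)) g) ∂haarSL2pm :=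
        setLIntegral_mono' measurableSet_gaussFD hpt
    _ = ∫⁻ _ in gaussFD, ENNReal.ofReal A ∂haarSL2pm +
          ∫⁻ g in gaussFD, ENNReal.ofReal B * T.indicator (fun g => ENNReal.ofReal (yOf g ^ 2)) g ∂haarSL2pm :=
        lintegral_add_left measurable_const _
    _ = ENNReal.ofReal A * haarSL2pm gaussFD +
          ENNReal.ofReal B * ∫⁻ g in gaussFD ∩ T, ENNReal.ofReal (yOf g ^ 2) ∂haarSL2pm := by
        rw [setLIntegral_const, lintegral_const_mul _ hind, setLIntegral_indicator hTm, Set.inter_comm]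
    _ ≤ ENNReal.ofReal A * (ENNReal.ofReal (π / 3) * ENNReal.ofReal π) +
          ENNReal.ofReal B * (ENNReal.ofReal (Real.sqrt (Lam D X)) * ENNReal.ofReal π) := by
        rw [haarSL2pm_gaussFD]
        gcongr
        exact lintegral_gaussFD_sq_le _
    _ = ENNReal.ofReal (A * (π ^ 2 / 3) + B * (Real.sqrt (Lam D X) * π)) := by
        rw [← ENNReal.ofReal_mul (by positivity : (0:ℝ) ≤ π / 3), ← ENNReal.ofReal_mul hA0,
          ← ENNReal.ofReal_mul (Real.sqrt_nonneg _), ← ENNReal.ofReal_mul hB0,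
          ← ENNReal.ofReal_add (by positivity) (by positivity)]
        congr 1; ring

end Measure

/-! ## Stabilisers: generic forms have `|Stab_Γ| ≤ 2` -/

/-- `γ = ofIntGL (intGL γ)`. [folklore] -/
theorem ofIntGL_intGL (γ : gl2zGL) : ofIntGL (intGL γ) = γ := by
  apply Subtype.ext
  show Matrix.GeneralLinearGroup.map (Int.castRingHom ℝ) (intGL γ) = (γ : GL (Fin 2) ℝ)
  rw [← coe_eq_map_intGL]

/-- **A form with `Δ ≠ 0` and no integral stabilising element `≠ ±1` has `|Stab_Γ| ≤ 2`.**
[cite: BhargavaShankarAnnals2015, §2.3 (the weights 1/|Stab| in eq. (7); generic forms) and Lemma 2.4 (arXiv:1006.1002v2 numbering)] -/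
theorem encard_stabilizer_le_two {x : BinaryQuartic ℤ}
    (hgen : ¬ ∃ γ : Matrix (Fin 2) (Fin 2) ℤ, IsUnit γ.det ∧ γ ≠ 1 ∧ γ ≠ -1 ∧ x.subst γ = x) :
    (MulAction.stabilizer gl2zGL x : Set gl2zGL).encard ≤ 2 := by
  have hsub : (MulAction.stabilizer gl2zGL x : Set gl2zGL) ⊆ {ofIntGL 1, ofIntGL (-1)} := by
    intro γ hγ
    have hfix : x.subst ((intGL γ : GL (Fin 2) ℤ) : Matrix (Fin 2) (Fin 2) ℤ) = x := by
      rw [← gl2z_smul_def]; exact hγ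
    have hunit : IsUnit ((intGL γ : GL (Fin 2) ℤ) : Matrix (Fin 2) (Fin 2) ℤ).det := by
      rw [← Matrix.GeneralLinearGroup.val_det_apply]; exact Units.isUnit _
    have hcases : ((intGL γ : GL (Fin 2) ℤ) : Matrix (Fin 2) (Fin 2) ℤ) = 1 ∨
        ((intGL γ : GL (Fin 2) ℤ) : Matrix (Fin 2) (Fin 2) ℤ) = -1 := by
      by_contra h
      push Not at h
      exact hgen ⟨_, hunit, h.1, h.2, hfix⟩
    rw [← ofIntGL_intGL γ]
    rcases hcases with h | h
    · left
      congr 1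
      exact Units.ext h
    · right
      rw [Set.mem_singleton_iff]
      congr 1
      exact Units.ext (by rw [h]; simp)
  calc (MulAction.stabilizer gl2zGL x : Set gl2zGL).encard ≤ ({ofIntGL 1, ofIntGL (-1)} : Set gl2zGL).encard :=
        Set.encard_le_encard hsub
    _ ≤ 2 := by
        refine (Set.encard_insert_le _ _).trans ?_
        rw [Set.encard_singleton]; norm_num

/-! ## Orbits with a big stabiliser -/

open Literature.LinearAlgebra.Matrix.GL2ZNormalForm in
/-- **The orbits of forms with `Δ ≠ 0`, `H < X` and a big stabiliser form a finite set** (they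
are represented by the three finite normal-form families of `BhargavaShankarBigStabilizers`).
[cite: BhargavaShankarAnnals2015, Lemma 2.4 (arXiv:1006.1002v2 numbering)] -/
theorem finite_bigStab_orbits {X : ℝ} (hX : 1 ≤ X) :
    (gl2zOrbit '' {f : BinaryQuartic ℤ | f.disc ≠ 0 ∧ f.height < X ∧
        ∃ γ : Matrix (Fin 2) (Fin 2) ℤ, IsUnit γ.det ∧ γ ≠ 1 ∧ γ ≠ -1 ∧ f.subst γ = f}).Finite := by
  have hX0 : 0 ≤ X := by linarith
  set Y : ℝ := X ^ (1 / 6 : ℝ) with hYdef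
  have hY1 : 1 ≤ Y := Real.one_le_rpow hX (by norm_num)
  have hY6 : Y ^ 6 = X := by
    rw [hYdef, ← Real.rpow_natCast, ← Real.rpow_mul hX0]; norm_num
  set T1 := {f : BinaryQuartic ℤ | f.b = 0 ∧ f.d = 0 ∧ f.disc ≠ 0 ∧ f.height < Y ^ 6}
  set T2 := {f : BinaryQuartic ℤ | f.subst γ₂ = f ∧ f.disc ≠ 0 ∧ f.height < Y ^ 6}
  set TS := {f : BinaryQuartic ℤ | f.e = f.a ∧ f.d = -f.b ∧ f.height < Y ^ 6}
  obtain ⟨hfin1, -⟩ := ncard_fix1_le hY1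
  obtain ⟨hfin2, -⟩ := ncard_fix2_le hY1
  obtain ⟨hfinS, -⟩ := ncard_fixS_le hY1
  have hfin := ((hfin1.union hfin2).union hfinS).image gl2zOrbit
  refine hfin.subset ?_
  rintro _ ⟨f, ⟨hΔ, hH, γ, hγ, h1, h2, hfix⟩, rfl⟩
  obtain ⟨f', hequiv, hf'⟩ := exists_equiv_fixed_normal hΔ hγ h1 h2 hfix
  obtain ⟨δ, hδ, rfl⟩ := hequiv
  have hΔ' : (f.subst δ).disc ≠ 0 := by
    rw [disc_subst]; exact mul_ne_zero (pow_ne_zero _ hδ.ne_zero) hΔ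
  have hH' : (f.subst δ).height < Y ^ 6 := by rw [height_subst_of_isUnit f hδ, hY6]; exact hH
  refine ⟨f.subst δ, ?_, (gl2zOrbit_eq_of_equiv (f := f) (g := f.subst δ) ⟨δ, hδ, rfl⟩).symm⟩
  rcases hf' with h | h | h
  · obtain ⟨hb, hd⟩ := bd_of_subst_γ₁ h
    exact Or.inl (Or.inl ⟨hb, hd, hΔ', hH'⟩)
  · exact Or.inl (Or.inr ⟨h, hΔ', hH'⟩)
  · obtain ⟨he, hd⟩ := ae_of_subst_S h
    exact Or.inr ⟨he, hd, hH'⟩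

/-- The big-stabiliser orbits inside any set `𝒮` of forms with `Δ ≠ 0`, `H < X` number
`≤ 32500 X^{2/3}`. [cite: BhargavaShankarAnnals2015, Lemma 2.4 (arXiv:1006.1002v2 numbering)] -/
theorem ncard_bigStab_orbits_subset_le {X : ℝ} (hX : 1 ≤ X) {𝒮 : Set (BinaryQuartic ℤ)}
    (hΔ : ∀ x ∈ 𝒮, x.disc ≠ 0) (hH : ∀ x ∈ 𝒮, x.height < X) :
    ((gl2zOrbit '' {f : BinaryQuartic ℤ | f ∈ 𝒮 ∧
        ∃ γ : Matrix (Fin 2) (Fin 2) ℤ, IsUnit γ.det ∧ γ ≠ 1 ∧ γ ≠ -1 ∧ f.subst γ = f}).ncard : ℝ) ≤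
      32500 * X ^ (2 / 3 : ℝ) := by
  have hsub : gl2zOrbit '' {f : BinaryQuartic ℤ | f ∈ 𝒮 ∧
        ∃ γ : Matrix (Fin 2) (Fin 2) ℤ, IsUnit γ.det ∧ γ ≠ 1 ∧ γ ≠ -1 ∧ f.subst γ = f} ⊆
      gl2zOrbit '' {f : BinaryQuartic ℤ | f.disc ≠ 0 ∧ f.height < X ∧
        ∃ γ : Matrix (Fin 2) (Fin 2) ℤ, IsUnit γ.det ∧ γ ≠ 1 ∧ γ ≠ -1 ∧ f.subst γ = f} :=
    Set.image_mono fun f hf => ⟨hΔ f hf.1, hH f hf.1, hf.2⟩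
  have h := Set.ncard_le_ncard hsub (finite_bigStab_orbits hX)
  exact le_trans (by exact_mod_cast h) (ncard_bigStab_orbits_le hX)

/-! ## The orbit inequality of the averaging method (upper half) -/

section Orbits

variable [MeasurableSpace (Matrix (Fin 2) (Fin 2) ℝ)] [BorelSpace (Matrix (Fin 2) (Fin 2) ℝ)]

/-- **`#{generic orbits} · nᵣ μ(G₀)/2 ≤ ∫_𝓕 N dμ`.** Let `𝓛` be a section set, `𝒮` a
`Γ`-invariant set of integral forms each `SL₂^±(ℝ)`-equivalent to a form of `𝓛` whose real
stabiliser has at least `nᵣ` elements. Then the orbits of `𝒮` without a big stabiliser, times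
`nᵣ μ(G₀)/2`, are bounded by the averaging integral: by the unfolding `∫_𝓕 N = Σ_O w(O)` and
`|Stab_Γ(O)| w(O) = μ(E(x_O)) = |Stab_ℝ| μ(G₀)` with `|Stab_Γ| ≤ 2` for generic orbits
(Bhargava–Shankar, eq. (7)). [cite: BhargavaShankarAnnals2015, §2.3 eqs. (5)–(7) (arXiv:1006.1002v2 numbering)] -/
theorem encard_orbits_mul_le_lintegral {𝓛 : Set (BinaryQuartic ℝ)} (h𝓛 : IsSectionSet 𝓛)
    {𝒮 : Set (BinaryQuartic ℤ)} (h𝒮 : ∀ (γ : gl2zGL) (x : BinaryQuartic ℤ), x ∈ 𝒮 → γ • x ∈ 𝒮)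
    (hcov : ∀ x ∈ 𝒮, ∃ ℓ₀ ∈ 𝓛, ∃ g₀ : Matrix (Fin 2) (Fin 2) ℝ, (g₀.det = 1 ∨ g₀.det = -1) ∧
      x.map (Int.castRingHom ℝ) = ℓ₀.subst g₀)
    {nR : ℕ} (hnR : ∀ ℓ ∈ 𝓛, nR ≤ (substStabilizer ℓ).ncard) :
    ((gl2zOrbit '' {f : BinaryQuartic ℤ | f ∈ 𝒮 ∧
        ¬ ∃ γ : Matrix (Fin 2) (Fin 2) ℤ, IsUnit γ.det ∧ γ ≠ 1 ∧ γ ≠ -1 ∧ f.subst γ = f}).encard : ℝ≥0∞) *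
        ((nR : ℝ≥0∞) * haarSL2pm G0 / 2) ≤
      ∫⁻ g in gaussFD, countFn 𝓛 𝒮 g ∂haarSL2pm := by
  set Orb := gl2zOrbit '' 𝒮 with hOrb
  set Gen := gl2zOrbit '' {f : BinaryQuartic ℤ | f ∈ 𝒮 ∧
    ¬ ∃ γ : Matrix (Fin 2) (Fin 2) ℤ, IsUnit γ.det ∧ γ ≠ 1 ∧ γ ≠ -1 ∧ f.subst γ = f} with hGen
  set c : ℝ≥0∞ := (nR : ℝ≥0∞) * haarSL2pm G0 / 2 with hc
  have hsub : Gen ⊆ Orb := Set.image_mono fun f hf => hf.1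
  rw [lintegral_countFn_eq_tsum_orbits h𝓛 h𝒮]
  -- each generic orbit has weight `≥ c`
  have hw : ∀ O ∈ Gen, c ≤ orbitWeight 𝓛 O := by
    rintro _ ⟨x₀, ⟨hx₀, hgen⟩, rfl⟩
    obtain ⟨ℓ₀, hℓ₀, g₀, hg₀, hxe⟩ := hcov x₀ hx₀
    have hE : haarSL2pm (Eset 𝓛 x₀) = (substStabilizer ℓ₀).ncard * haarSL2pm G0 := measure_Eset_eq h𝓛 hℓ₀ hg₀ hxe
    have hmul := encard_stabilizer_mul_orbitWeight h𝓛 x₀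
    have h2 := encard_stabilizer_le_two hgen
    have hlow : (nR : ℝ≥0∞) * haarSL2pm G0 ≤ orbitWeight 𝓛 (gl2zOrbit x₀) * 2 := by
      calc (nR : ℝ≥0∞) * haarSL2pm G0 ≤ (substStabilizer ℓ₀).ncard * haarSL2pm G0 := by
            gcongr; exact_mod_cast hnR ℓ₀ hℓ₀
        _ = (MulAction.stabilizer gl2zGL x₀ : Set gl2zGL).encard * orbitWeight 𝓛 (gl2zOrbit x₀) := by rw [hmul, hE]
        _ ≤ 2 * orbitWeight 𝓛 (gl2zOrbit x₀) := by
            gcongr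
            exact_mod_cast h2
        _ = orbitWeight 𝓛 (gl2zOrbit x₀) * 2 := mul_comm _ _
    exact ENNReal.div_le_of_le_mul hlow
  -- sum over generic orbits ≤ sum over all orbits
  calc (Gen.encard : ℝ≥0∞) * c = ∑' _ : Gen, c := (ENNReal.tsum_set_const Gen c).symm
    _ ≤ ∑' O : Gen, orbitWeight 𝓛 (O : Set (BinaryQuartic ℤ)) := ENNReal.tsum_le_tsum fun O => hw O O.2
    _ = ∑' O : Set (BinaryQuartic ℤ), Gen.indicator (fun O => orbitWeight 𝓛 O) O := tsum_subtype Gen _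
    _ ≤ ∑' O : Set (BinaryQuartic ℤ), Orb.indicator (fun O => orbitWeight 𝓛 O) O :=
        ENNReal.tsum_le_tsum fun O => Set.indicator_le_indicator_of_subset hsub (fun _ => zero_le) O
    _ = ∑' O : Orb, orbitWeight 𝓛 (O : Set (BinaryQuartic ℤ)) := (tsum_subtype Orb _).symm

/-- **The orbit count of the averaging method with congruence conditions (upper bound).** For
`X ≥ 1`, pieces `D` whose sections `𝓛_X` form a section set, a `Γ`-invariant set `𝒮` of
irreducible integral forms of height `< X` with reductions modulo `q` in `S`, each
`SL₂^±(ℝ)`-equivalent to a section whose real stabiliser has `≥ nᵣ ≥ 1` elements: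
`#(Γ\𝒮) ≤ 32500 X^{2/3} + (2/(nᵣ μ(G₀))) (#S X^{5/6} vol(B₁)/q⁵ · π²/3 + #S·576000KΛ⁴·√Λ·π)`.
[cite: BhargavaShankarAnnals2015, §2.3 (eqs. (5)–(7), (14)–(15), Lemma 2.4) and §2.5 Thm 2.11 (arXiv:1006.1002v2 numbering)] -/
theorem ncard_orbits_le {X : ℝ} (hX : 1 ≤ X) (h𝓛 : IsSectionSet (sections D X))
    {q : ℕ} [NeZero q] (S : Finset (Fin 5 → ZMod q))
    {𝒮 : Set (BinaryQuartic ℤ)} (h𝒮 : ∀ (γ : gl2zGL) (x : BinaryQuartic ℤ), x ∈ 𝒮 → γ • x ∈ 𝒮)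
    (hirr : ∀ f ∈ 𝒮, f.IsIrreducible) (hH : ∀ f ∈ 𝒮, f.height < X)
    (hred : ∀ f ∈ 𝒮, (fun i => ((f.coeffs i : ℤ) : ZMod q)) ∈ S)
    (hcov : ∀ x ∈ 𝒮, ∃ ℓ₀ ∈ sections D X, ∃ g₀ : Matrix (Fin 2) (Fin 2) ℝ, (g₀.det = 1 ∨ g₀.det = -1) ∧
      x.map (Int.castRingHom ℝ) = ℓ₀.subst g₀)
    {nR : ℕ} (hnRpos : 0 < nR) (hnR : ∀ ℓ ∈ sections D X, nR ≤ (substStabilizer ℓ).ncard) :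
    ((gl2zOrbit '' 𝒮).ncard : ℝ) ≤ 32500 * X ^ (2 / 3 : ℝ) +
      2 / (nR * boxHaar) *
        (S.card * (X ^ (5 / 6 : ℝ) * volume.real (B1set D) / (q : ℝ) ^ 5) * (π ^ 2 / 3) +
          S.card * (576000 * K * Lam D X ^ 4) * (Real.sqrt (Lam D X) * π)) := by
  have hX0 : 0 < X := by linarith
  have hΔ : ∀ x ∈ 𝒮, x.disc ≠ 0 := fun x hx => disc_ne_zero_of_isIrreducible (hirr x hx)
  set Big := {f : BinaryQuartic ℤ | f ∈ 𝒮 ∧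
    ∃ γ : Matrix (Fin 2) (Fin 2) ℤ, IsUnit γ.det ∧ γ ≠ 1 ∧ γ ≠ -1 ∧ f.subst γ = f} with hBig
  set GenS := {f : BinaryQuartic ℤ | f ∈ 𝒮 ∧
    ¬ ∃ γ : Matrix (Fin 2) (Fin 2) ℤ, IsUnit γ.det ∧ γ ≠ 1 ∧ γ ≠ -1 ∧ f.subst γ = f} with hGenS
  set M : ℝ := S.card * (X ^ (5 / 6 : ℝ) * volume.real (B1set D) / (q : ℝ) ^ 5) * (π ^ 2 / 3) +
    S.card * (576000 * K * Lam D X ^ 4) * (Real.sqrt (Lam D X) * π) with hM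
  have hM0 : 0 ≤ M := by have := Lam_pos D hX0; positivity
  -- finiteness of all orbit sets involved
  have hfinOrb : (gl2zOrbit '' 𝒮).Finite :=
    (finite_gl2zOrbits_of_isIrreducible X).subset (Set.image_mono fun f hf => ⟨hirr f hf, hH f hf⟩)
  have hunion : gl2zOrbit '' 𝒮 = gl2zOrbit '' GenS ∪ gl2zOrbit '' Big := by
    rw [← Set.image_union]; congr 1; ext f
    simp only [hGenS, hBig, Set.mem_setOf_eq, Set.mem_union]; tauto
  have hfinGen : (gl2zOrbit '' GenS).Finite := hfinOrb.subset (Set.image_mono fun f hf => hf.1)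
  -- the generic orbits
  have hgen : ((gl2zOrbit '' GenS).ncard : ℝ) * (nR * boxHaar / 2) ≤ M := by
    have h := encard_orbits_mul_le_lintegral h𝓛 h𝒮 hcov hnR
    have h' := h.trans (lintegral_countFn_le D hX S hirr hred)
    rw [← hfinGen.cast_ncard_eq, ENat.toENNReal_coe] at h'
    have hG0 : haarSL2pm G0 = ENNReal.ofReal boxHaar := by
      rw [boxHaar_eq, ENNReal.ofReal_toReal haarSL2pm_G0_ne_top]
    rw [hG0] at h'
    have e : ((gl2zOrbit '' GenS).ncard : ℝ≥0∞) * ((nR : ℝ≥0∞) * ENNReal.ofReal boxHaar / 2) =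
        ENNReal.ofReal (((gl2zOrbit '' GenS).ncard : ℝ) * (nR * boxHaar / 2)) := by
      rw [ENNReal.ofReal_mul (by positivity), ENNReal.ofReal_natCast, ENNReal.ofReal_div_of_pos two_pos,
        ENNReal.ofReal_mul (by positivity), ENNReal.ofReal_natCast, ENNReal.ofReal_ofNat]
    rw [e] at h'
    exact (ENNReal.ofReal_le_ofReal_iff hM0).1 h'
  have hbH := boxHaar_pos
  have hnR' : (0 : ℝ) < nR := by exact_mod_cast hnRpos
  have hgen' : ((gl2zOrbit '' GenS).ncard : ℝ) ≤ 2 / (nR * boxHaar) * M := by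
    rw [div_mul_eq_mul_div, le_div_iff₀ (by positivity)]
    nlinarith
  have hbig := ncard_bigStab_orbits_subset_le hX hΔ hH
  calc ((gl2zOrbit '' 𝒮).ncard : ℝ) ≤ ((gl2zOrbit '' GenS).ncard : ℝ) + ((gl2zOrbit '' Big).ncard : ℝ) := by
        rw [hunion]; exact_mod_cast Set.ncard_union_le _ _
    _ ≤ 2 / (nR * boxHaar) * M + 32500 * X ^ (2 / 3 : ℝ) := add_le_add hgen' hbig
    _ = _ := by rw [hM]; ring

end Orbits

end BinaryQuartic

end Literature.NumberTheory.EllipticCurves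

end
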